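import Summits.BirchSwinnertonDyer.BirchSwinnertonDyer.Theorems.GenusKolyvaginAtTwoGenusPrimitiveSupplyAtTwoLoweringStepNoTwoTorsion
import Literature.NumberTheory.EllipticCurves.TwoAdicImageQuadraticTwistProofs
import HarnessLib

/-!
# Route `GenusKolyvaginAtTwo`, crux #2 `GenusPrimitiveSupplyAtTwo` (stmt-BirchSwinnertonDyer-22136):
# Mazur–Rubin 2010 Theorem 1.5 (existence half) at `p = 2` over `ℚ` — twists of EVERY smaller `2`-Selmer rank of the same parity,
# inside a prescribed congruence class — from `prop52_rat` (hence from {PT, Tate χ})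

Lead seat `bsd-line-gk2-p1` g8 (cell `bsd-f1-sign2`). THEOREMS ONLY (no definition, no named fact, no `sorry`); helper
`--supports stmt-BirchSwinnertonDyer-22136`; no item is closed; BSD is not proved by any of this.

Mazur–Rubin 2010, proof of Thm. 1.5 («Theorem (thm2)», arXiv:0904.3709 p. 12): «Suppose `0 ≤ r ≤ d₂(E/K)`. Applying Proposition 5.2
`(d₂(E/K)−r)/2` times shows that `E` has a twist `E′` with `d₂(E′/K) = r`». Over `ℚ`, with Prop. 5.2 in its proof form (twisting
primes `≡ 1` modulo any modulus), the twisting parameter is a square-free `u ≡ 1 (mod m)`; this is the general-rank form of gk2-p5's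
walk `GenusKoly.exists_twist_card_selmerGroup_two_of_lowering` (target rank `1` from odd rank) used by the crux's twin SUPPLY.

* `natCard_torsionBy_two_quadraticTwist_eq_one` — `#E(ℚ)[2] = 1 ⟹ #E^{(d)}(ℚ)[2] = 1` (tree `forall_two_nsmul_quadraticTwist_iff`).
* **`exists_squarefree_twist_card_selmerGroup_eq_of_prop52`** — granted `MazurRubin2010.prop52_rat`: any elliptic `W/ℚ` with
  `#W(ℚ)[2] = 1`, `#Sel₂(W) = 2^{r + 2k}`, `m ≠ 0` ⟹ a square-free `u ≡ 1 (mod m)` with `#Sel₂(W^{(u)}) = 2^r`.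
* **`exists_squarefree_twist_card_selmerGroup_eq_of_duality`** — the same from {`poitouTate_selmerStructure_duality_real ℚ`,
  `localEulerPoincareCharacteristic`} via `prop52_rat_of_duality`.

References: [MazurRubin2010] Thm. 1.5 and its proof («Proof of Theorem (thm2)», arXiv:0904.3709 p. 12), Prop. 5.2; [MilneADT2006] I Thm. 4.10.
-/

set_option linter.dupNamespace false -- tree convention: `Summit.BirchSwinnertonDyer.BirchSwinnertonDyer.Theorems` (summit = sub-problem)
set_option autoImplicit false

noncomputable section

open scoped AddSubgroup

namespace Summit.BirchSwinnertonDyer.BirchSwinnertonDyer.Theorems.GenusKolyLowering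

open WeierstrassCurve NumberField IsDedekindDomain
open Literature.NumberTheory.EllipticCurves Literature.NumberTheory.GaloisRepresentations
  Literature.NumberTheory.GaloisCohomology

/-- `#A[2] = 1 ↔ every `2`-torsion element is `0`. [folklore] -/
theorem natCard_torsionBy_two_eq_one_iff {A : Type*} [AddCommGroup A] :
    Nat.card (A[((2 : ℕ) : ℤ)]) = 1 ↔ ∀ P : A, 2 • P = 0 → P = 0 := by
  constructor
  · intro h P hP
    have hsub : Subsingleton (A[((2 : ℕ) : ℤ)]) := (Nat.card_eq_one_iff_unique.mp h).1
    have := hsub.elim ⟨P, AddSubgroup.torsionBy.nsmul_iff.mpr hP⟩ ⟨0, AddSubgroup.zero_mem _⟩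
    exact congrArg Subtype.val this
  · intro h
    rw [Nat.card_eq_one_iff_unique]
    refine ⟨⟨fun x y ↦ ?_⟩, ⟨0⟩⟩
    have hx : (x : A) = 0 := h x (AddSubgroup.torsionBy.nsmul_iff.mp x.2)
    have hy : (y : A) = 0 := h y (AddSubgroup.torsionBy.nsmul_iff.mp y.2)
    exact Subtype.ext (hx.trans hy.symm)

/-- **No rational `2`-torsion is twist-invariant**: `#W(ℚ)[2] = 1 ⟹ #W^{(d)}(ℚ)[2] = 1` (`d ≠ 0`; the `2`-division cubic is the
same up to scaling — tree `forall_two_nsmul_quadraticTwist_iff`). [cite: SilvermanAEC2009, X.5 Cor. 5.4] -/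
theorem natCard_torsionBy_two_quadraticTwist_eq_one (W : WeierstrassCurve ℚ) [W.IsElliptic] {d : ℚ} (hd : d ≠ 0)
    (h : Nat.card (W.toAffine.Point[((2 : ℕ) : ℤ)]) = 1) :
    haveI := W.isElliptic_quadraticTwist hd
    Nat.card ((W.quadraticTwist d).toAffine.Point[((2 : ℕ) : ℤ)]) = 1 := by
  haveI := W.isElliptic_quadraticTwist hd
  exact natCard_torsionBy_two_eq_one_iff.mpr
    ((forall_two_nsmul_quadraticTwist_iff W hd).mpr (natCard_torsionBy_two_eq_one_iff.mp h))

/-- **Mazur–Rubin Thm. 1.5 (existence half) over `ℚ`, from Prop. 5.2**: for any elliptic `W/ℚ` with `#W(ℚ)[2] = 1` and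
`#Sel₂(W) = 2^{r + 2k}`, and any modulus `m ≠ 0`, there is a square-free `u ≡ 1 (mod m)` (a product of `k` primes `≡ 1 (mod m)`)
with `#Sel₂(W^{(u)}) = 2^r`. Induction on `k`, twisting by one Prop.-5.2 prime at a time (`(W^{(u)})^{(p)} = W^{(up)}`:
`quadraticTwist_quadraticTwist`; the twists keep `#(·)(ℚ)[2] = 1`; the modulus is multiplied by the primes already used so that
`u` stays square-free). CONDITIONAL on `hMR : MazurRubin2010.prop52_rat`.
[cite: MazurRubin2010, Thm. 1.5 (proof, arXiv:0904.3709 p. 12) and Prop. 5.2] -/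
theorem exists_squarefree_twist_card_selmerGroup_eq_of_prop52 (hMR : MazurRubin2010.prop52_rat) (r k : ℕ) :
    ∀ (W : WeierstrassCurve ℚ) [W.IsElliptic], Nat.card (W.toAffine.Point[((2 : ℕ) : ℤ)]) = 1 →
      Nat.card (W.selmerGroup 2) = 2 ^ (r + 2 * k) → ∀ m : ℕ, m ≠ 0 →
        ∃ u : ℕ, Squarefree u ∧ (u : ℤ) ≡ 1 [ZMOD (m : ℤ)] ∧
          Nat.card ((W.quadraticTwist (u : ℚ)).selmerGroup 2) = 2 ^ r := by
  induction k with
  | zero =>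
    intro W _ _ hSel m _
    refine ⟨1, squarefree_one, Int.ModEq.refl _, ?_⟩
    obtain ⟨C, hC⟩ := W.exists_variableChange_quadraticTwist_one
    haveI := W.isElliptic_quadraticTwist (one_ne_zero : (1 : ℚ) ≠ 0)
    have h := natCard_selmerGroup_smul W C two_ne_zero
    rw [Nat.cast_ofNat, hC] at h
    rw [Nat.cast_one, h]
    simpa using hSel
  | succ k ih =>
    intro W _ htors hSel m hm
    have hs : 1 < r + 2 * (k + 1) := by omega
    obtain ⟨p, hp, hpm, hSelp⟩ := hMR W htors (r + 2 * (k + 1)) hSel hs m hm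
    have hp0 : (p : ℚ) ≠ 0 := by exact_mod_cast hp.ne_zero
    haveI := W.isElliptic_quadraticTwist hp0
    have htors' := natCard_torsionBy_two_quadraticTwist_eq_one W hp0 htors
    have hk : r + 2 * (k + 1) - 2 = r + 2 * k := by omega
    rw [hk] at hSelp
    have hmp : m * p ≠ 0 := mul_ne_zero hm hp.ne_zero
    obtain ⟨u₁, hu₁, hu₁m, hSel'⟩ := ih (W.quadraticTwist (p : ℚ)) htors' hSelp (m * p) hmp
    have hu₁m' : (u₁ : ℤ) ≡ 1 [ZMOD (m : ℤ)] := hu₁m.of_dvd (by exact_mod_cast Dvd.intro p rfl)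
    have hu₁p : (u₁ : ℤ) ≡ 1 [ZMOD (p : ℤ)] := hu₁m.of_dvd (by exact_mod_cast Dvd.intro_left m rfl)
    have hpu : ¬ p ∣ u₁ := fun h ↦ by
      have hdu : (p : ℤ) ∣ (u₁ : ℤ) := by exact_mod_cast h
      have h1 : (p : ℤ) ∣ 1 := by simpa using Int.dvd_sub hdu (Int.ModEq.dvd hu₁p.symm)
      exact hp.one_lt.ne' (by exact_mod_cast Int.eq_one_of_dvd_one (by positivity) h1)
    refine ⟨p * u₁, ?_, ?_, ?_⟩
    · exact (Nat.squarefree_mul (hp.coprime_iff_not_dvd.mpr hpu)).mpr ⟨hp.squarefree, hu₁⟩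
    · have := hpm.mul hu₁m'
      simpa using this
    · rw [Nat.cast_mul, ← quadraticTwist_quadraticTwist]
      exact hSel'

/-- **Mazur–Rubin Thm. 1.5 (existence half) at `p = 2` over `ℚ`, modulo {PT, Tate χ} only**: `#W(ℚ)[2] = 1`, `#Sel₂(W) = 2^{r+2k}`,
`m ≠ 0` ⟹ a square-free `u ≡ 1 (mod m)` with `#Sel₂(W^{(u)}) = 2^r` — via `prop52_rat_of_duality`.
[cite: MazurRubin2010, Thm. 1.5 (proof, arXiv:0904.3709 p. 12) and Prop. 5.2] [cite: MilneADT2006, Ch. I, Thm. 4.10] -/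
theorem exists_squarefree_twist_card_selmerGroup_eq_of_duality
    (hPT : poitouTate_selmerStructure_duality_real ℚ)
    (hEP : ∀ v : HeightOneSpectrum (𝓞 ℚ), localEulerPoincareCharacteristic (v.adicCompletion ℚ))
    (W : WeierstrassCurve ℚ) [W.IsElliptic] (htors : Nat.card (W.toAffine.Point[((2 : ℕ) : ℤ)]) = 1)
    {r k : ℕ} (hSel : Nat.card (W.selmerGroup 2) = 2 ^ (r + 2 * k)) {m : ℕ} (hm : m ≠ 0) :
    ∃ u : ℕ, Squarefree u ∧ (u : ℤ) ≡ 1 [ZMOD (m : ℤ)] ∧ Nat.card ((W.quadraticTwist (u : ℚ)).selmerGroup 2) = 2 ^ r :=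
  exists_squarefree_twist_card_selmerGroup_eq_of_prop52 (prop52_rat_of_duality hPT hEP) r k W htors hSel m hm

end Summit.BirchSwinnertonDyer.BirchSwinnertonDyer.Theorems.GenusKolyLowering

end
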